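import Literature.NumberTheory.EllipticCurves.NewformPadicIntegralModel
import Literature.NumberTheory.EllipticCurves.OrdinaryPadicDataExistsProofs
import Literature.NumberTheory.EllipticCurves.IwasawaLambdaNorm
import Literature.NumberTheory.EllipticCurves.CyclotomicPAdicLFunctionWeightK
import Literature.NumberTheory.EllipticCurves.EmertonPollackWeston2006.HidaFamilyTransfer
import Literature.NumberTheory.EllipticCurves.PAdicBSD
import Literature.NumberTheory.EllipticCurves.PAdicLFunctionMultiplicativeInterpolation
import HarnessLib

/-!
# Emerton–Pollack–Weston, *Variation of Iwasawa invariants in Hida families* (Invent. Math. 163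
# (2006)): Thm. 3.1.1 (cotorsion), Thm. 1 (μ^alg, instance `f_E ↦ g`) and Thm. 5.1.3 with Thm. 4.4.5
# (instance `g ↦ f_E`) for a good-ordinary higher-weight member `g` of the Hida family of an elliptic
# curve with multiplicative reduction at `p` — named facts (D-0014), class X11a of the BSD residual cell

HONEST FRAMING (cell `b2b-bsdres`, home `run/shared/lean/b2b/bsd-rank1-residual/`): the cell deletes
COMBINATION-SHAPED residual classes of the rank-`≤ 1` BSD formula from PUBLISHED theorems only and
types the rest; this is not "finishing BSD". This file vendors three printed statements as named
facts (`def … : Prop`, nothing asserted, no `_holds`), each as an INSTANCE for the pair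
(`f_E` = the `p`-new weight-two member attached to `E`, `g` = a good-ordinary weight-`k` member,
`k ≡ 2 (mod p−1)`, `k > 2`, level `N/p`) of the Hida family `H(E[p])`, in the Greenberg–Selmer
vocabulary of `GreenbergSelmerNewform.lean` (harvest-2: `Cofree`, `OrdinaryFiltration`, `DualData`,
`charIdeal`) and the `p`-adic coefficient ring / integral model / member predicate of
`NewformPadicIntegralModel.lean`; the analytic side uses `IsCycPAdicLFunctionWeightK`
(`CyclotomicPAdicLFunctionWeightK.lean`) and `normLam` (`IwasawaLambdaNorm.lean`; = EPW Def. 4.4.6).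
The companion file `HidaFamilyTransfer.lean` vendored Cor. 5.1.4/Thm. 5.1.3 between two ELLIPTIC
CURVES (audited R33.4); this file is the higher-weight-member version the X11a chain needs
(HOME/b2b-bsdres-x11a/X11A-CHAIN.md; literature audit HOME/b2b-bsdres-lit/g14/X11A-AUDIT.md; the
review of p204620 ruled that the ASSEMBLED chain may not be a fact and asked for exactly these
separate instances). The cell's socket `Summits/BirchSwinnertonDyer/Rank1Residual/X11a/ChainSocket.lean`
composes them (with Wan 2015 Thm. 4, file `Wan2015RationalMainConjecture.lean`) into Mazur's main
conjecture / BSD(E,p) at a (ram)-free multiplicative prime modulo the per-pair certificate `μ^an(E,p) = 0`.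

## Source (arXiv:math/0404484; pages of that text, read by the cell's literature seat)

* p. 2: "Let `ρ̄ : G_ℚ → GL₂(k)` be an absolutely irreducible modular Galois representation … Assume
  further that `ρ̄` is `p`-ordinary and `p`-distinguished … The Hida family `H(ρ̄)` of `ρ̄` is the set
  of all `p`-ordinary `p`-stabilized newforms `f` with mod `p` Galois representation isomorphic to
  `ρ̄` … **Theorem 1.** Fix `* ∈ {alg, an}`. If `μ^*(f₀) = 0` for some `f₀ ∈ H(ρ̄)`, then `μ^*(f) = 0`
  for all `f ∈ H(ρ̄)`."; p. 5: "We fix an odd prime `p`".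
* p. 17, §3.1 (verbatim in `GreenbergSelmerNewform.lean`): `K`, `𝒪`, `π`, the integral model
  `ρ_f : G_ℚ → GL₂(𝒪)`, `A_f`, (eq:ordes), Greenberg's `Sel(ℚ_∞, A_f)`, "`μ^alg(f)` (resp. `λ^alg(f)`)
  is defined to be the largest power of `π` dividing (resp. the number of zeroes of) the
  characteristic power series of the `Λ_𝒪`-dual of `Sel(ℚ_∞, A_f)` (assuming that this Selmer group
  is `Λ_𝒪`-cotorsion). **Theorem 3.1.1.** Let `f` be a `p`-ordinary and `p`-stabilized newform with
  `ρ̄_f` absolutely irreducible. Then `Sel(ℚ_∞, A_f)` is co-finitely generated, `Λ_𝒪`-cotorsion … [KKT]".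
* p. 24: "**Theorem 4.4.5.** The following are equivalent: • There is one ordinary newform `f` in the
  Hida family of `ρ̄` for which the `p`-adic `L`-function `L_p(f,ω^i)` has vanishing `μ`-invariant.
  • For every ordinary newform `f` in the Hida family of `ρ̄`, the `p`-adic `L`-function `L_p(f,ω^i)`
  has vanishing `μ`-invariant. • … If the equivalent conditions of the preceding theorem hold, then
  we write `μ^an(ρ̄,ω^i) = 0`. … **Definition 4.4.6.** … `λ(f(T))` [is] the smallest degree in which
  `f(T)` has a unit coefficient."
* p. 30, §5.1: "`L_p^alg(f,ω^i) ∈ Λ_𝒪` a generator of the characteristic power series of the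
  `Λ_𝒪`-dual of `Sel(ℚ_∞,A_{f,i})` … `L_p^an(f,ω^i) ∈ Λ_𝒪` the usual `p`-adic `L`-function of `f ⊗ ω^i`
  (computed with respect to some canonical period) … **Theorem 5.1.3.** Let … `ρ̄` be an irreducible,
  modular, `p`-ordinary and `p`-distinguished representation … Suppose that
  `μ^alg(f₀,ω^i) = μ^an(f₀,ω^i) = 0` and `λ^alg(f₀,ω^i) = λ^an(f₀,ω^i)` for some `f₀` in the Hida family
  attached to `ρ̄` and some `i`. Then `μ^alg(f,ω^i) = μ^an(f,ω^i) = 0` and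
  `λ^alg(f,ω^i) = λ^an(f,ω^i)` for every `f` in the Hida family attached to `ρ̄`."
* p. 32, Ex. 5.3.1: the weight-two newform of `X₀(11)` (split multiplicative at `p = 11`, `p`-new) IS a
  member of `H(ρ̄)` to and from which the transfer runs.

## Faithfulness of the instance (bridges — the same as `HidaFamilyTransfer.lean`, audited R33.4)
* `ρ̄ = E[p]` with `E[p]` irreducible and `p ‖ N`, `p ≥ 5`: absolutely irreducible (odd, Schur),
  `p`-ordinary and `p`-distinguished (Tate curve), modular; `f_E ∈ H(E[p])` (Ex. 5.3.1);
  `(g, ι)` with `IsOrdinaryMemberOf W p g ι` is in `H(E[p])` (congruences of all `a_ℓ`, `ℓ ∤ N`, and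
  Brauer–Nesbitt–Chebotarev give `ρ̄_{g,ι} ≅ E[p]`).
* E-side currencies: EPW's `Sel(ℚ_∞, A_{f_E})` is Greenberg's; the tree's `W.SelmerDualData` is the
  dual of the classical `Sel_{p^∞}(E/ℚ_∞)`; their characteristic ideals differ by the trivial-zero
  factor `T^e` (`e = 1` split, `0` non-split), of unit content — Skinner 2016 §3.2 (arXiv:1407.1093
  p0014), Greenberg LNM 1716 Prop. 2.4 and PDF p. 82 — so `μ^alg(f_E) = 0` ⟺ `μ(X(E/ℚ_∞)) = 0`
  (the tree's `SelmerDualData.mu`) and `λ^alg(f_E) = λ(fE) + e` for a generator `fE` of the classical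
  characteristic ideal. EPW's `L_p^an(f_E)` is normalised by a canonical period, the tree's MTT
  function by the Néron period `Ω_E` (`ϖ·Ω_E = Ω⁺_f`): at `p ‖ N` under (irr) they differ by a
  `p`-adic unit (Greenberg–Vatsal 2000 §3 Prop. (3.1)/(3.3); Skinner 2016 §3.3), so `μ^an(f_E) = 0` ⟺
  the Néron-normalised series has a unit coefficient, and `λ^an(f_E) = λ(gK) + e` for the Kato element
  `gK` (`ι(T^e gK) = ϖ·L_p`). `λ` = `normLam` (Def. 4.4.6; scale-invariant).
* `g`-side: `μ^alg(g) = 0` ⟺ a generator of `charIdeal` of the `Λ_𝒪`-dual has a coefficient of norm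
  `1` (i.e. is not divisible by `π`); `λ^alg(g) = normLam` of that generator (number of zeroes =
  Weierstrass degree when `μ = 0`); `λ^an(g) = normLam L` for THE cyclotomic `p`-adic `L`-function `L`
  of `(g, ι, υ)` in any Shimura normalisation (`IsCycPAdicLFunctionWeightK`; the canonical period
  changes `L` by a non-zero constant, `λ` not at all). `μ^an(g) = 0` is NOT expressible without the
  canonical period and is supplied, inside Thm. 5.1.3, in the equivalent form "`μ^an(f_E) = 0`" of
  Thm. 4.4.5 ((1) ⇔ (2)), flag `EPW-canonical-period` (N1 of the audit).
-/

noncomputable section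

open scoped Classical MatrixGroups ModularForm

open NumberField IsDedekindDomain Field CongruenceSubgroup
open Literature.NumberTheory.GaloisRepresentations
open Literature.NumberTheory.EllipticCurves.ModularForms
open Literature.NumberTheory.EllipticCurves.GreenbergVatsal2000

namespace Literature.NumberTheory.EllipticCurves.EmertonPollackWeston2006

/-- **Emerton–Pollack–Weston 2006, Thm. 3.1.1 (cotorsion; [Kato], [KKT]), instance: a good-ordinary
weight-`k` member of `H(E[p])`.** "Let `f` be a `p`-ordinary and `p`-stabilized newform with `ρ̄_f`
absolutely irreducible. Then `Sel(ℚ_∞, A_f)` is co-finitely generated, `Λ_𝒪`-cotorsion"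
(arXiv:math/0404484 p. 17). Instance: `E/ℚ` globally minimal, `5 ≤ p`, `p ‖ N` (multiplicative),
`E[p]` irreducible; `(g, ι)` an ordinary member of `H(E[p])` of level `N/p` (`IsOrdinaryMemberOf`, so
`ρ̄_{g,ι} ≅ E[p]` is absolutely irreducible); for ALL ordinary `p`-adic data `𝔇` of `(g, ι)` (unit root,
integral model, ordinary filtration), the cyclotomic `ℤ_p`-extension `κ` with topological generator
`γ`, and every `Λ_𝒪`-dual datum `D` of Greenberg's `Sel(ℚ_∞, A_g)`: `D.X` is finitely generated and
torsion over `Λ_𝒪 = 𝒪⟦T⟧`. Named fact; nothing asserted.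
**RETIRED-SUBSUMED (cell `b2b-bsdres`, registry A84; cell-lead record 2026-08-21 executing referee
rulings R127.3 / R2-67.2, deprecate-and-add endorsed):** this is the level-`N/p` INSTANCE of the
printed theorem; the print ranges over the members of `H(ρ̄)` of EVERY tame level prime to `p`
(EPW p. 2, §2.1) and is vendored as the level-generic twin
`thm311_cotorsion_weightK_member_ofLevel` below, from which this instance FOLLOWS
(`thm311_cotorsion_weightK_member.of_ofLevel`, proved). The `X11a` chain of record
(`Summits/BirchSwinnertonDyer/Rank1Residual/X11a/ChainAnyLevel.lean`,
`X11a.forall_bsdp_of_namedFacts_ofLevel_heightFree`) binds the twin; the legacy `X11a/Chain*`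
theorems still binding `h311 : thm311_cotorsion_weightK_member` are superseded as record and are
being re-pointed (x11a `DEPRECATION-SWEEP.md`). This `def` is kept verbatim (statement unchanged)
only so that those importers elaborate; new consumers bind the `_ofLevel` twin; it is removed once
no module references it.
-- TODO(general form): any p-ordinary p-stabilised newform with ρ̄ absolutely irreducible, twists ω^i.
[cite: EmertonPollackWeston2006, Thm. 3.1.1 (arXiv:math/0404484 p. 17)] -/
def thm311_cotorsion_weightK_member : Prop :=
  ∀ (W : WeierstrassCurve ℚ) [W.IsElliptic] [W.IsGloballyMinimal] (p : ℕ) [Fact p.Prime],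
    5 ≤ p → W.HasMultiplicativeReductionAtPrime p → W.HasIrreducibleModPGaloisRep p →
    ∀ [NeZero (W.conductorNorm ℤ / p)] {k : ℤ} (g : CuspForm (Gamma0 (W.conductorNorm ℤ / p)) k)
      (ι : coeffField g →+* PadicAlgCl p), IsOrdinaryMemberOf W p g ι →
    ∀ (𝔇 : OrdinaryPadicData g p ι) (κ : ZpExtension ℚ p) (γ : Field.absoluteGaloisGroup ℚ),
      κ.IsCyclotomic → κ.IsTopGenerator γ →
    ∀ (D : GreenbergSelmer.DualData (padicCoeffField (memberGenerators g ι 𝔇.υ)) κ γ 𝔇.ρ 𝔇.plus),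
      Module.Finite (PowerSeries (padicCoeffIntegers (memberGenerators g ι 𝔇.υ))) D.X ∧
        Module.IsTorsion (PowerSeries (padicCoeffIntegers (memberGenerators g ι 𝔇.υ))) D.X

/-- **Emerton–Pollack–Weston 2006, Thm. 1 with `* = alg`, instance `f₀ = f_E ↦ f = g`.** "Fix
`* ∈ {alg, an}`. If `μ^*(f₀) = 0` for some `f₀ ∈ H(ρ̄)`, then `μ^*(f) = 0` for all `f ∈ H(ρ̄)`"
(arXiv:math/0404484 p. 2; `ρ̄` absolutely irreducible, `p`-ordinary, `p`-distinguished; `μ^alg` of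
§3.1 p. 17: "the largest power of `π` dividing the characteristic power series of the `Λ_𝒪`-dual of
`Sel(ℚ_∞, A_f)`"). Instance and bridges (module docstring): `E/ℚ` globally minimal, `5 ≤ p`, `p ‖ N`,
`E[p]` irreducible; HYPOTHESIS `μ^alg(f_E) = 0` as "`X(E/ℚ_∞)` is `Λ`-torsion with `μ = 0` for every
cyclotomic datum and every dual datum" (tree `SelmerDualData.IsTorsion`, `.mu`; Greenberg vs
classical Selmer: trivial-zero factor of unit content, Skinner 2016 §3.2); CONCLUSION `μ^alg(g) = 0`
for every ordinary member `(g, ι)` of level `N/p`: for all ordinary `p`-adic data, cyclotomic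
`(κ, γ)`, dual data `D` and every generator `G` of `charIdeal(D)`, some coefficient of `G` has
`p`-adic norm `1` (is a unit of `𝒪`: not divisible by `π`). Named fact; nothing asserted.
**RETIRED-SUBSUMED (cell `b2b-bsdres`, registry A85; cell-lead record 2026-08-21 executing referee
rulings R127.3 / R2-67.2, deprecate-and-add endorsed):** level-`N/p` INSTANCE; the print compares
members of `H(ρ̄)` of arbitrary tame levels (EPW p. 2, Thm. 2) and is vendored as the level-generic
twin `thm1_muAlg_of_weightK_member_ofLevel` below, from which this instance FOLLOWS
(`thm1_muAlg_of_weightK_member.of_ofLevel`, proved). The `X11a` chain of record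
(`X11a/ChainAnyLevel.lean`, `X11a.forall_bsdp_of_namedFacts_ofLevel_heightFree`) binds the twin;
the legacy `X11a/Chain*` theorems still binding `hT1a : thm1_muAlg_of_weightK_member` are superseded
as record and are being re-pointed (x11a `DEPRECATION-SWEEP.md`). Kept verbatim (statement
unchanged) only so that those importers elaborate; new consumers bind the `_ofLevel` twin; removed
once no module references it.
-- TODO(general form): Thm. 1 for arbitrary pairs f₀, f ∈ H(ρ̄) and twists ω^i; * = an needs
-- canonical periods (here only through Thm. 4.4.5 inside `thm513_transfer_from_weightK_member`).
[cite: EmertonPollackWeston2006, Thm. 1 (arXiv:math/0404484 p. 2) and §3.1 (p. 17)]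
[cite: Skinner2016PacificMC, §3.2 (arXiv:1407.1093 p0014 L12–L40)] -/
def thm1_muAlg_of_weightK_member : Prop :=
  ∀ (W : WeierstrassCurve ℚ) [W.IsElliptic] [W.IsGloballyMinimal] (p : ℕ) [Fact p.Prime],
    5 ≤ p → W.HasMultiplicativeReductionAtPrime p → W.HasIrreducibleModPGaloisRep p →
    -- `μ^alg(f_E) = 0`
    (∀ (κ : ZpExtension ℚ p) (γ : Field.absoluteGaloisGroup ℚ), κ.IsCyclotomic →
        κ.IsTopGenerator γ → IsCyclotomicVariable p γ →
        ∀ D : W.SelmerDualData κ γ, D.IsTorsion ∧ D.mu = 0) →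
    ∀ [NeZero (W.conductorNorm ℤ / p)] {k : ℤ} (g : CuspForm (Gamma0 (W.conductorNorm ℤ / p)) k)
      (ι : coeffField g →+* PadicAlgCl p), IsOrdinaryMemberOf W p g ι →
    ∀ (𝔇 : OrdinaryPadicData g p ι) (κ : ZpExtension ℚ p) (γ : Field.absoluteGaloisGroup ℚ),
      κ.IsCyclotomic → κ.IsTopGenerator γ → IsCyclotomicVariable p γ →
    ∀ (D : GreenbergSelmer.DualData (padicCoeffField (memberGenerators g ι 𝔇.υ)) κ γ 𝔇.ρ 𝔇.plus),
      Module.IsTorsion (PowerSeries (padicCoeffIntegers (memberGenerators g ι 𝔇.υ))) D.X →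
    ∀ G : PowerSeries (padicCoeffIntegers (memberGenerators g ι 𝔇.υ)),
      D.charIdeal = Ideal.span {G} →
      ∃ n : ℕ, ‖((PowerSeries.coeff n G : padicCoeffIntegers (memberGenerators g ι 𝔇.υ)) :
        PadicAlgCl p)‖ = 1

/-- **Emerton–Pollack–Weston 2006, Thm. 5.1.3 with source `f₀ = g` (a good-ordinary weight-`k`
member) and target `f = f_E` (the `p`-new weight-two member, Ex. 5.3.1), its hypothesis `μ^an(g) = 0`
being supplied in the equivalent form `μ^an(f_E) = 0` of Thm. 4.4.5 ((1) ⇔ (2)).** Thm. 5.1.3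
(arXiv:math/0404484 p. 30): "Suppose that `μ^alg(f₀,ω^i) = μ^an(f₀,ω^i) = 0` and
`λ^alg(f₀,ω^i) = λ^an(f₀,ω^i)` for some `f₀` in the Hida family attached to `ρ̄` and some `i`. Then
`μ^alg(f,ω^i) = μ^an(f,ω^i) = 0` and `λ^alg(f,ω^i) = λ^an(f,ω^i)` for every `f` in the Hida family
attached to `ρ̄`"; Thm. 4.4.5 (p. 24): `μ^an` vanishes for one ordinary newform of the family iff for
every one. Instance and bridges (module docstring): `E/ℚ` globally minimal, `5 ≤ p`, `p ‖ N`, `E[p]`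
irreducible, `(g, ι)` an ordinary member of level `N/p` with ordinary `p`-adic data `𝔇`, cyclotomic
`(κ, γ)`, a TORSION dual datum `D` with generator `G` of `charIdeal(D)`, a Shimura period datum
`Dsym` and `L` with `IsCycPAdicLFunctionWeightK g Dsym p ι 𝔇.υ L` (THE cyclotomic `p`-adic
`L`-function of `g`; `i = 0`). HYPOTHESES at `f₀ = g`: `μ^alg(g) = 0` (some coefficient of `G` has norm
`1`), `λ^alg(g) = λ^an(g)` (`normLam G = normLam L`, Def. 4.4.6), and `μ^an(g) = 0` AS `μ^an(f_E) = 0`: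
for every newform `f` of `W` and `ϖ` with `ϖ·Ω_E = Ω⁺_f`, some coefficient of `ϖ·L_p` (THE Mazur–Tate–
Teitelbaum function of `E`, Néron period; canonical period up to a unit at `p ‖ N` under (irr) —
Greenberg–Vatsal 2000 §3, Skinner 2016 §3.3, flag `EPW-canonical-period`) is a `p`-adic unit.
CONCLUSION at `f = f_E`, in the tree's normalisation: for the cyclotomic data, every newform `f` of
`W`, dual datum `D'` of `Sel_{p^∞}(E/ℚ_∞)`, `ϖ`, generator `fE` of `char_Λ X` and Kato element `gK`
(`ι(gK) = ϖ·L_p` non-split, `ι(T·gK) = ϖ·L_p` split): `gK`, `fE` have unit content and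
`normLam gK = normLam fE` (= "`μ^alg(f_E) = μ^an(f_E) = 0` and `λ^alg(f_E) = λ^an(f_E)`", the factor
`T^e` cancelling — Skinner 2016 §3.2). Named fact; nothing asserted.
QUANTIFICATION NOTE (literature seat `lit-su` gen 2, 2026-08-20): here `L` ranges over EVERY
interpolant of `IsCycPAdicLFunctionWeightK`, a predicate that does not determine `L` (`L + log(1+T)`
satisfies it too; it is unbounded, `normLam` of it is the junk value `0`, and the hypothesis
"`λ^alg(g) = λ^an(g)`" then degenerates to `λ^alg(g) = 0`, under which the source does not assert the
conclusion); EPW's `λ^an(g)` is `λ` of THE `p`-adic `L`-function `L_p^an(g) ∈ Λ_𝒪` — the BOUNDED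
interpolant. The print-faithful quantification is `thm513_transfer_from_weightK_member_of_bdd` below
(one extra binder, the boundedness clause that `exists_isCycPAdicLFunctionWeightK` delivers with `L`);
importers should migrate to it; this declaration is kept unchanged for them meanwhile.
**RETIRED-OVERQUANTIFIED (cell `b2b-bsdres`, registry A86; referee ruling R121.2, 2026-08-20,
endorsing `lit-su` SU2014-TYPING §5/§8; deprecate-and-add):** with `L` ranging over every
interpolant of `IsCycPAdicLFunctionWeightK` the hypothesis `normLam gK = normLam L` degenerates at the
unbounded interpolants (junk `λ = 0`), so this statement is STRONGER than print at those `L` (not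
known false, not print-faithful). SUPERSEDED by `thm513_transfer_from_weightK_member_of_bdd` below
(registry A146: bounded `L` = EPW's `L_p^an(f, ω^i) ∈ Λ_𝒪`), uniqueness of the bounded interpolant by
the tree THEOREM `IsCycPAdicLFunctionWeightK.eq_of_bounded` (`CyclotomicInterpolantUniquenessProofs.lean`,
p241451). Consumers: the `X11a` chain was re-based on the `_of_bdd` facts
(`Summits/…/X11a/ChainBounded.lean`, p241299, confirmed by the `x11a` seat 2026-08-21 as the base of
its chain of record); the legacy `X11a/Chain*` theorems still binding
`hT1b : thm513_transfer_from_weightK_member` are to be re-pointed. This `def` is kept verbatim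
(statement unchanged) only so that those importers elaborate; do not use it; it is removed once no
module references it.
-- TODO(general form): Thm. 5.1.3 for arbitrary f₀, f ∈ H(ρ̄), twists ω^i; μ^an via canonical periods.
[cite: EmertonPollackWeston2006, Thm. 5.1.3 (arXiv:math/0404484 p. 30), Thm. 4.4.5 and Def. 4.4.6 (p. 24), Thm. 1 (p. 2), Ex. 5.3.1 (p. 32)]
[cite: Skinner2016PacificMC, §3.2 (arXiv:1407.1093 p0014) and §3.3 (p0016)]
[cite: GreenbergVatsal2000, §3 Prop. (3.1), Prop. (3.3)] -/
def thm513_transfer_from_weightK_member : Prop :=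
  ∀ (W : WeierstrassCurve ℚ) [W.IsElliptic] [W.IsGloballyMinimal] (p : ℕ) [Fact p.Prime],
    5 ≤ p → W.HasMultiplicativeReductionAtPrime p → W.HasIrreducibleModPGaloisRep p →
    ∀ [NeZero (W.conductorNorm ℤ / p)] {k : ℤ} (g : CuspForm (Gamma0 (W.conductorNorm ℤ / p)) k)
      (ι : coeffField g →+* PadicAlgCl p), IsOrdinaryMemberOf W p g ι →
    ∀ (𝔇 : OrdinaryPadicData g p ι) (κ : ZpExtension ℚ p) (γ : Field.absoluteGaloisGroup ℚ),
      κ.IsCyclotomic → κ.IsTopGenerator γ → IsCyclotomicVariable p γ →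
    ∀ (D : GreenbergSelmer.DualData (padicCoeffField (memberGenerators g ι 𝔇.υ)) κ γ 𝔇.ρ 𝔇.plus),
      Module.IsTorsion (PowerSeries (padicCoeffIntegers (memberGenerators g ι 𝔇.υ))) D.X →
    ∀ G : PowerSeries (padicCoeffIntegers (memberGenerators g ι 𝔇.υ)),
      D.charIdeal = Ideal.span {G} →
    ∀ (Dsym : PeriodSymbolDatum g) (L : PowerSeries (PadicAlgCl p)),
      IsCycPAdicLFunctionWeightK g Dsym p ι 𝔇.υ L →
    -- hypotheses of Thm. 5.1.3 at `f₀ = g`: `μ^alg(g) = 0`, `λ^alg(g) = λ^an(g)` …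
    (∃ n : ℕ, ‖((PowerSeries.coeff n G : padicCoeffIntegers (memberGenerators g ι 𝔇.υ)) :
        PadicAlgCl p)‖ = 1) →
    normLam (PowerSeries.map (padicCoeffIntegers (memberGenerators g ι 𝔇.υ)).subtype G) = normLam L →
    -- … and `μ^an(g) = 0` in the form `μ^an(f_E) = 0` (Thm. 4.4.5), Néron-normalised
    (∀ {N : ℕ} [NeZero N] (f : CuspForm (Gamma0 N) 2), IsNewformOf W f →
        ∀ (ϖ : ℚ), (ϖ : ℝ) * W.realPeriodRat = plusPeriod f →
          (¬ W.HasSplitMultiplicativeReductionAtPrime p →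
            ∀ Lp : PowerSeries ℚ_[p], IsMultPAdicLFunctionOf f p (-1) Lp →
              ∃ n : ℕ, ‖PowerSeries.coeff n (PowerSeries.C ((ϖ : ℚ) : ℚ_[p]) * Lp)‖ = 1) ∧
          (W.HasSplitMultiplicativeReductionAtPrime p →
            ∀ Lp : PowerSeries ℚ_[p], IsSplitMultPAdicLFunctionOf f p Lp →
              ∃ n : ℕ, ‖PowerSeries.coeff n (PowerSeries.C ((ϖ : ℚ) : ℚ_[p]) * Lp)‖ = 1)) →
    -- conclusion at `f = f_E`: `μ = 0` and `λ^alg(f_E) = λ^an(f_E)`, at every Kato pair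
    ∀ (κ' : ZpExtension ℚ p) (γ' : Field.absoluteGaloisGroup ℚ),
        κ'.IsCyclotomic → κ'.IsTopGenerator γ' → IsCyclotomicVariable p γ' →
      ∀ {N : ℕ} [NeZero N] (f : CuspForm (Gamma0 N) 2), IsNewformOf W f →
      ∀ (D' : W.SelmerDualData κ' γ') (ϖ : ℚ), (ϖ : ℝ) * W.realPeriodRat = plusPeriod f →
      ∀ (fE gK : IwasawaAlgebra p), D'.charIdeal = Ideal.span {fE} →
        (¬ W.HasSplitMultiplicativeReductionAtPrime p →
          ∀ Lp : PowerSeries ℚ_[p], IsMultPAdicLFunctionOf f p (-1) Lp →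
            iwasawaToPowerSeries p gK = PowerSeries.C ((ϖ : ℚ) : ℚ_[p]) * Lp →
              HasUnitContent gK ∧ HasUnitContent fE ∧ normLam gK = normLam fE) ∧
        (W.HasSplitMultiplicativeReductionAtPrime p →
          ∀ Lp : PowerSeries ℚ_[p], IsSplitMultPAdicLFunctionOf f p Lp →
            iwasawaToPowerSeries p (PowerSeries.X * gK) = PowerSeries.C ((ϖ : ℚ) : ℚ_[p]) * Lp →
              HasUnitContent gK ∧ HasUnitContent fE ∧ normLam gK = normLam fE)

/-! ### The print-faithful quantification of Thm. 5.1.3's analytic hypothesis: THE (bounded)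
cyclotomic `p`-adic `L`-function of `g` (literature seat `lit-su` gen 2, 2026-08-20;
HOME/b2b-bsdres-lit-su/SU2014-TYPING.md §5, §8) -/

/-- **Emerton–Pollack–Weston 2006, Thm. 5.1.3 with source `f₀ = g` and target `f = f_E` (Thm. 4.4.5
for `μ^an`) — the same instance as `thm513_transfer_from_weightK_member`, with the analytic
hypothesis at `g` quantified AS PRINTED: `λ^an(g) = λ(L)` for THE cyclotomic `p`-adic `L`-function
`L` of `(g, ι, υ)`, i.e. for an interpolant of `IsCycPAdicLFunctionWeightK g Dsym p ι υ` with BOUNDED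
coefficients (`∃ C, ∀ i, ‖[Tⁱ]L‖ ≤ C`, the clause delivered together with `L` by
`exists_isCycPAdicLFunctionWeightK`; EPW p. 30: "`L_p^an(f,ω^i) ∈ Λ_𝒪` the usual `p`-adic
`L`-function", an Iwasawa function, so bounded; Mazur–Tate–Teitelbaum 1986 §I.11).** Why the binder
is part of the statement: the interpolation property alone does not single out `L` — `L + log(1+T)`
has it as well (`log(1+T)` has constant term `0` and vanishes at every `ζ − 1`, `ζ ∈ μ_{p^∞}`); that
series is unbounded, its `normLam` is the junk value `0`, and the hypothesis `normLam G = normLam L`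
would then read `λ^alg(g) = 0`, under which Thm. 5.1.3 asserts nothing; among BOUNDED series the
interpolant is unique (a bounded series vanishing at all `ζ − 1` is `0` — Newton polygon;
Weierstrass preparation when the coefficients lie in a finite extension of `ℚ_p`, the tree's
`MemIwasawaRat.eq_zero_of_forall_hasSum_zero` being the `ℚ_p`-coefficient case) and equals `L_p^an(g)` up to the non-zero period constant, which
`normLam` ignores — so the typed hypothesis IS "`λ^alg(g) = λ^an(g)`". Everything else — instance,
bridges, hypotheses `μ^alg(g) = 0`, `μ^an(f_E) = 0` (Néron-normalised, Thm. 4.4.5), and the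
CONCLUSION at `f = f_E` (unit contents and `normLam gK = normLam fE` at every Kato pair) — VERBATIM
as in `thm513_transfer_from_weightK_member` and the module docstring. Named fact; nothing asserted;
no `_holds`. `thm513_transfer_from_weightK_member_of_bdd.of_unrestricted` records that this statement
is implied by (is weaker than) the unrestricted one. Flag as there (`EPW-canonical-period`).
**RETIRED-SUBSUMED (cell `b2b-bsdres`, registry A146; cell-lead record 2026-08-21 executing referee
rulings R127.3 / R2-67.2, deprecate-and-add endorsed):** level-`N/p` INSTANCE (source member `g` of
level `N/p`); Thm. 5.1.3 compares `f₀`, `f ∈ H(ρ̄)` of possibly different tame levels and is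
vendored as the level-generic twin `thm513_transfer_from_weightK_member_of_bdd_ofLevel` below (source
of ANY level `M`, `p ∤ M`), from which this instance FOLLOWS
(`thm513_transfer_from_weightK_member_of_bdd.of_ofLevel`, proved). The `X11a` chain of record
(`X11a/ChainAnyLevel.lean`, `X11a.forall_bsdp_of_namedFacts_ofLevel_heightFree`) binds the twin;
the `X11a/ChainBounded*` / `ChainPrimeConductor` theorems binding
`hT1b : thm513_transfer_from_weightK_member_of_bdd` are superseded as record and are being
re-pointed. Kept verbatim (statement unchanged) only so that those importers elaborate; new
consumers bind the `_ofLevel` twin; removed, together with `.of_unrestricted`, once no module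
references it.
-- TODO(general form): as for `thm513_transfer_from_weightK_member`.
[cite: EmertonPollackWeston2006, Thm. 5.1.3 (arXiv:math/0404484 p. 30), Thm. 4.4.5 and Def. 4.4.6 (p. 24), Thm. 1 (p. 2), Ex. 5.3.1 (p. 32)]
[cite: Skinner2016PacificMC, §3.2 (arXiv:1407.1093 p0014) and §3.3 (p0016)]
[cite: GreenbergVatsal2000, §3 Prop. (3.1), Prop. (3.3)]
[cite: MazurTateTeitelbaum1986Invent, §I.11 and §I.14 (14.3)] -/
def thm513_transfer_from_weightK_member_of_bdd : Prop :=
  ∀ (W : WeierstrassCurve ℚ) [W.IsElliptic] [W.IsGloballyMinimal] (p : ℕ) [Fact p.Prime],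
    5 ≤ p → W.HasMultiplicativeReductionAtPrime p → W.HasIrreducibleModPGaloisRep p →
    ∀ [NeZero (W.conductorNorm ℤ / p)] {k : ℤ} (g : CuspForm (Gamma0 (W.conductorNorm ℤ / p)) k)
      (ι : coeffField g →+* PadicAlgCl p), IsOrdinaryMemberOf W p g ι →
    ∀ (𝔇 : OrdinaryPadicData g p ι) (κ : ZpExtension ℚ p) (γ : Field.absoluteGaloisGroup ℚ),
      κ.IsCyclotomic → κ.IsTopGenerator γ → IsCyclotomicVariable p γ →
    ∀ (D : GreenbergSelmer.DualData (padicCoeffField (memberGenerators g ι 𝔇.υ)) κ γ 𝔇.ρ 𝔇.plus),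
      Module.IsTorsion (PowerSeries (padicCoeffIntegers (memberGenerators g ι 𝔇.υ))) D.X →
    ∀ G : PowerSeries (padicCoeffIntegers (memberGenerators g ι 𝔇.υ)),
      D.charIdeal = Ideal.span {G} →
    ∀ (Dsym : PeriodSymbolDatum g) (L : PowerSeries (PadicAlgCl p)),
      IsCycPAdicLFunctionWeightK g Dsym p ι 𝔇.υ L →
      (∃ C : ℝ, ∀ i, ‖PowerSeries.coeff i L‖ ≤ C) →
    -- hypotheses of Thm. 5.1.3 at `f₀ = g`: `μ^alg(g) = 0`, `λ^alg(g) = λ^an(g)` …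
    (∃ n : ℕ, ‖((PowerSeries.coeff n G : padicCoeffIntegers (memberGenerators g ι 𝔇.υ)) :
        PadicAlgCl p)‖ = 1) →
    normLam (PowerSeries.map (padicCoeffIntegers (memberGenerators g ι 𝔇.υ)).subtype G) = normLam L →
    -- … and `μ^an(g) = 0` in the form `μ^an(f_E) = 0` (Thm. 4.4.5), Néron-normalised
    (∀ {N : ℕ} [NeZero N] (f : CuspForm (Gamma0 N) 2), IsNewformOf W f →
        ∀ (ϖ : ℚ), (ϖ : ℝ) * W.realPeriodRat = plusPeriod f →
          (¬ W.HasSplitMultiplicativeReductionAtPrime p →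
            ∀ Lp : PowerSeries ℚ_[p], IsMultPAdicLFunctionOf f p (-1) Lp →
              ∃ n : ℕ, ‖PowerSeries.coeff n (PowerSeries.C ((ϖ : ℚ) : ℚ_[p]) * Lp)‖ = 1) ∧
          (W.HasSplitMultiplicativeReductionAtPrime p →
            ∀ Lp : PowerSeries ℚ_[p], IsSplitMultPAdicLFunctionOf f p Lp →
              ∃ n : ℕ, ‖PowerSeries.coeff n (PowerSeries.C ((ϖ : ℚ) : ℚ_[p]) * Lp)‖ = 1)) →
    -- conclusion at `f = f_E`: `μ = 0` and `λ^alg(f_E) = λ^an(f_E)`, at every Kato pair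
    ∀ (κ' : ZpExtension ℚ p) (γ' : Field.absoluteGaloisGroup ℚ),
        κ'.IsCyclotomic → κ'.IsTopGenerator γ' → IsCyclotomicVariable p γ' →
      ∀ {N : ℕ} [NeZero N] (f : CuspForm (Gamma0 N) 2), IsNewformOf W f →
      ∀ (D' : W.SelmerDualData κ' γ') (ϖ : ℚ), (ϖ : ℝ) * W.realPeriodRat = plusPeriod f →
      ∀ (fE gK : IwasawaAlgebra p), D'.charIdeal = Ideal.span {fE} →
        (¬ W.HasSplitMultiplicativeReductionAtPrime p →
          ∀ Lp : PowerSeries ℚ_[p], IsMultPAdicLFunctionOf f p (-1) Lp →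
            iwasawaToPowerSeries p gK = PowerSeries.C ((ϖ : ℚ) : ℚ_[p]) * Lp →
              HasUnitContent gK ∧ HasUnitContent fE ∧ normLam gK = normLam fE) ∧
        (W.HasSplitMultiplicativeReductionAtPrime p →
          ∀ Lp : PowerSeries ℚ_[p], IsSplitMultPAdicLFunctionOf f p Lp →
            iwasawaToPowerSeries p (PowerSeries.X * gK) = PowerSeries.C ((ϖ : ℚ) : ℚ_[p]) * Lp →
              HasUnitContent gK ∧ HasUnitContent fE ∧ normLam gK = normLam fE)

/-- The print-faithful (bounded) quantification is WEAKER than the unrestricted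
`thm513_transfer_from_weightK_member`: restricting the interpolant `L` to the bounded ones only
drops instances. (So every consumer of the unrestricted fact may switch to the bounded one, feeding
it the boundedness clause of `exists_isCycPAdicLFunctionWeightK`.)
[cite: EmertonPollackWeston2006, Thm. 5.1.3 (arXiv:math/0404484 p. 30)] -/
theorem thm513_transfer_from_weightK_member_of_bdd.of_unrestricted
    (h : thm513_transfer_from_weightK_member) : thm513_transfer_from_weightK_member_of_bdd := by
  intro W _ _ p _ hp hmult hirr _ k g ι hmem 𝔇 κ γ hκ hγ hγ' D htors G hG Dsym L hL _ hμg hlam hμan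
  exact h W p hp hmult hirr g ι hmem 𝔇 κ γ hκ hγ hγ' D htors G hG Dsym L hL hμg hlam hμan


/-! ### Level-generic twins (sized ask S-g19-1 of the `x11a` seat; literature seat gen 40,
2026-08-21; deprecate-and-add)

The three instances above bind the member `(g, ι)` at level EXACTLY `N/p` (`IsOrdinaryMemberOf`),
only because the first producer of members in the tree (Hida 1986, the named fact
`hida_exists_congruent_ordinary_newform_of_multiplicative`, registry A77) delivers that level. The
PRINTED theorems quantify over the whole Hida family `H(ρ̄)` = "the set of ALL `p`-ordinary
`p`-stabilized newforms `f` with mod `p` Galois representation isomorphic to `ρ̄`" (EPW p. 2) —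
members of EVERY tame level prime to `p`: Thm. 3.1.1 (p. 17) is stated for "a `p`-ordinary and
`p`-stabilized newform with `ρ̄_f` absolutely irreducible" of "tame level `N`" arbitrary; Thm. 1
(p. 2) for "all `f ∈ H(ρ̄)`"; Thm. 5.1.3 (p. 30) for "every `f` in the Hida family attached to `ρ̄`",
and Thm. 2 (p. 2) / §5.2 explicitly compare members of different tame levels ("the sum is over
all primes dividing the tame level of `f₁` or `f₂`"). The twins below therefore replace the member
binder block `∀ [NeZero (N/p)] {k} (g : CuspForm (Gamma0 (N/p)) k) (ι), IsOrdinaryMemberOf W p g ι →`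
by `∀ {M} [NeZero M], ¬ p ∣ M → ∀ {k} (g : CuspForm (Gamma0 M) k) (ι), IsOrdinaryMemberOfLevel W p g ι →`
(`M` = the tame level, prime to `p`, so that `(g, ι, υ)` has an ordinary `p`-stabilisation — EPW's
standing "`p`-stabilized newform of tame level `N`", `p ∤ N`, §2.1 p. 6 "fix a tame level `N`
prime to `p`" / p. 8), and are otherwise BYTE-IDENTICAL to the instances they generalise (same
bridges, same bounded interpolant, same conclusion). Each level-`N/p` instance follows from its
twin at `M := N/p` (`….of_ofLevel`, using `p ∤ N/p` at a multiplicative `p`: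
`not_dvd_conductorNorm_div_of_hasMultiplicativeReductionAtPrime`), so consumers are unaffected
and the registry swap is deprecate-and-add (cell `b2b-bsdres`, HOME/CITED-FACTS.md). Consumer of
record to be: the `X11a` chain re-run with the modularity-produced member of SOME level `M′ ∣ N/p`
(`exists_isNewform0_dvd_conductorNorm_div_congr_of_multiplicative_of_exists_isNewformOf`,
`HidaFamilyMembersMultiplicativeProofs.lean`), which retires the Hida-1986 binder A77 on all of
X11a (HOME/b2b-bsdres-x11a/g19/S-g19-1-shapes.md). Named facts; nothing asserted; no `_holds`. -/

/-- **Emerton–Pollack–Weston 2006, Thm. 3.1.1 (cotorsion; [Kato], [KKT]) — level-generic twin of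
`thm311_cotorsion_weightK_member`: a good-ordinary weight-`k` member of `H(E[p])` of ANY tame level
`M` prime to `p`.** "Let `f` be a `p`-ordinary and `p`-stabilized newform with `ρ̄_f` absolutely
irreducible. Then `Sel(ℚ_∞, A_f)` is co-finitely generated, `Λ_𝒪`-cotorsion" (arXiv:math/0404484
p. 17; §3.1 opens "Let `f = ∑ aₙqⁿ` be a `p`-ordinary and `p`-stabilized newform of weight `k ≥ 2`,
tame level `N`, and character `χ`" — any tame level). Instance: `E/ℚ` globally minimal, `5 ≤ p`,
`p ‖ N` (multiplicative), `E[p]` irreducible; `M` with `p ∤ M`; `(g, ι)` an ordinary member of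
`H(E[p])` of level `M` (`IsOrdinaryMemberOfLevel`, so `ρ̄_{g,ι} ≅ E[p]` is absolutely irreducible);
for ALL ordinary `p`-adic data `𝔇` of `(g, ι)`, the cyclotomic `ℤ_p`-extension `κ` with topological
generator `γ`, and every `Λ_𝒪`-dual datum `D` of Greenberg's `Sel(ℚ_∞, A_g)`: `D.X` is finitely
generated and torsion over `Λ_𝒪 = 𝒪⟦T⟧`. Everything but the member binder block is byte-identical
to `thm311_cotorsion_weightK_member` (which is this statement at `M = N/p`:
`thm311_cotorsion_weightK_member.of_ofLevel`). Named fact; nothing asserted.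
-- TODO(general form): any p-ordinary p-stabilised newform with ρ̄ absolutely irreducible, twists ω^i.
[cite: EmertonPollackWeston2006, Thm. 3.1.1 and §3.1 (arXiv:math/0404484 p. 17), Intro p. 2 (H(ρ̄))] -/
def thm311_cotorsion_weightK_member_ofLevel : Prop :=
  ∀ (W : WeierstrassCurve ℚ) [W.IsElliptic] [W.IsGloballyMinimal] (p : ℕ) [Fact p.Prime],
    5 ≤ p → W.HasMultiplicativeReductionAtPrime p → W.HasIrreducibleModPGaloisRep p →
    ∀ {M : ℕ} [NeZero M], ¬ p ∣ M → ∀ {k : ℤ} (g : CuspForm (Gamma0 M) k)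
      (ι : coeffField g →+* PadicAlgCl p), IsOrdinaryMemberOfLevel W p g ι →
    ∀ (𝔇 : OrdinaryPadicData g p ι) (κ : ZpExtension ℚ p) (γ : Field.absoluteGaloisGroup ℚ),
      κ.IsCyclotomic → κ.IsTopGenerator γ →
    ∀ (D : GreenbergSelmer.DualData (padicCoeffField (memberGenerators g ι 𝔇.υ)) κ γ 𝔇.ρ 𝔇.plus),
      Module.Finite (PowerSeries (padicCoeffIntegers (memberGenerators g ι 𝔇.υ))) D.X ∧
        Module.IsTorsion (PowerSeries (padicCoeffIntegers (memberGenerators g ι 𝔇.υ))) D.X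

/-- The level-`N/p` instance `thm311_cotorsion_weightK_member` IS the level-generic twin at
`M := N/p` (`p ∤ N/p` at a multiplicative `p` of a globally minimal curve; an `IsOrdinaryMemberOf`
member is an `IsOrdinaryMemberOfLevel` member). Deprecate-and-add bookkeeping: the old fact is
implied by (weaker than) the new one.
[cite: EmertonPollackWeston2006, Thm. 3.1.1 (arXiv:math/0404484 p. 17)] -/
theorem thm311_cotorsion_weightK_member.of_ofLevel (h : thm311_cotorsion_weightK_member_ofLevel) :
    thm311_cotorsion_weightK_member := by
  intro W _ _ p _ hp hmult hirr _ k g ι hmem 𝔇 κ γ hκ hγ D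
  exact h W p hp hmult hirr (not_dvd_conductorNorm_div_of_hasMultiplicativeReductionAtPrime W p hmult)
    g ι (IsOrdinaryMemberOf.ofLevel hmem) 𝔇 κ γ hκ hγ D

/-- **Emerton–Pollack–Weston 2006, Thm. 1 with `* = alg`, instance `f₀ = f_E ↦ f = g` — level-generic
twin of `thm1_muAlg_of_weightK_member`: the target `g` a good-ordinary weight-`k` member of
`H(E[p])` of ANY tame level `M` prime to `p`.** "Fix `* ∈ {alg, an}`. If `μ^*(f₀) = 0` for some
`f₀ ∈ H(ρ̄)`, then `μ^*(f) = 0` for all `f ∈ H(ρ̄)`" (arXiv:math/0404484 p. 2; `H(ρ̄)` = "the set of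
all `p`-ordinary `p`-stabilized newforms `f` with mod `p` Galois representation isomorphic to `ρ̄`",
every tame level; `ρ̄` absolutely irreducible, `p`-ordinary, `p`-distinguished; `μ^alg` of §3.1
p. 17). Instance and bridges exactly as in `thm1_muAlg_of_weightK_member` and the module
docstring: `E/ℚ` globally minimal, `5 ≤ p`, `p ‖ N`, `E[p]` irreducible; HYPOTHESIS
`μ^alg(f_E) = 0` ("`X(E/ℚ_∞)` is `Λ`-torsion with `μ = 0` for every cyclotomic datum and every dual
datum"); CONCLUSION `μ^alg(g) = 0` for every ordinary member `(g, ι)` of level `M`, `p ∤ M`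
(`IsOrdinaryMemberOfLevel`): for all ordinary `p`-adic data, cyclotomic `(κ, γ)`, torsion dual data
`D` and every generator `G` of `charIdeal(D)`, some coefficient of `G` has `p`-adic norm `1`.
Byte-identical to `thm1_muAlg_of_weightK_member` except for the member binder block (that fact is
this one at `M = N/p`: `thm1_muAlg_of_weightK_member.of_ofLevel`). Named fact; nothing asserted.
-- TODO(general form): Thm. 1 for arbitrary pairs f₀, f ∈ H(ρ̄) and twists ω^i; * = an needs
-- canonical periods (here only through Thm. 4.4.5 inside the Thm. 5.1.3 facts).
[cite: EmertonPollackWeston2006, Thm. 1 and Intro p. 2 (H(ρ̄)) (arXiv:math/0404484 p. 2) and §3.1 (p. 17)]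
[cite: Skinner2016PacificMC, §3.2 (arXiv:1407.1093 p0014 L12–L40)] -/
def thm1_muAlg_of_weightK_member_ofLevel : Prop :=
  ∀ (W : WeierstrassCurve ℚ) [W.IsElliptic] [W.IsGloballyMinimal] (p : ℕ) [Fact p.Prime],
    5 ≤ p → W.HasMultiplicativeReductionAtPrime p → W.HasIrreducibleModPGaloisRep p →
    -- `μ^alg(f_E) = 0`
    (∀ (κ : ZpExtension ℚ p) (γ : Field.absoluteGaloisGroup ℚ), κ.IsCyclotomic →
        κ.IsTopGenerator γ → IsCyclotomicVariable p γ →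
        ∀ D : W.SelmerDualData κ γ, D.IsTorsion ∧ D.mu = 0) →
    ∀ {M : ℕ} [NeZero M], ¬ p ∣ M → ∀ {k : ℤ} (g : CuspForm (Gamma0 M) k)
      (ι : coeffField g →+* PadicAlgCl p), IsOrdinaryMemberOfLevel W p g ι →
    ∀ (𝔇 : OrdinaryPadicData g p ι) (κ : ZpExtension ℚ p) (γ : Field.absoluteGaloisGroup ℚ),
      κ.IsCyclotomic → κ.IsTopGenerator γ → IsCyclotomicVariable p γ →
    ∀ (D : GreenbergSelmer.DualData (padicCoeffField (memberGenerators g ι 𝔇.υ)) κ γ 𝔇.ρ 𝔇.plus),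
      Module.IsTorsion (PowerSeries (padicCoeffIntegers (memberGenerators g ι 𝔇.υ))) D.X →
    ∀ G : PowerSeries (padicCoeffIntegers (memberGenerators g ι 𝔇.υ)),
      D.charIdeal = Ideal.span {G} →
      ∃ n : ℕ, ‖((PowerSeries.coeff n G : padicCoeffIntegers (memberGenerators g ι 𝔇.υ)) :
        PadicAlgCl p)‖ = 1

/-- The level-`N/p` instance `thm1_muAlg_of_weightK_member` IS the level-generic twin at
`M := N/p`. Deprecate-and-add bookkeeping: the old fact is implied by (weaker than) the new one.
[cite: EmertonPollackWeston2006, Thm. 1 (arXiv:math/0404484 p. 2)] -/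
theorem thm1_muAlg_of_weightK_member.of_ofLevel (h : thm1_muAlg_of_weightK_member_ofLevel) :
    thm1_muAlg_of_weightK_member := by
  intro W _ _ p _ hp hmult hirr hμE _ k g ι hmem 𝔇 κ γ hκ hγ hγ' D htors G hG
  exact h W p hp hmult hirr hμE
    (not_dvd_conductorNorm_div_of_hasMultiplicativeReductionAtPrime W p hmult)
    g ι (IsOrdinaryMemberOf.ofLevel hmem) 𝔇 κ γ hκ hγ hγ' D htors G hG

/-- **Emerton–Pollack–Weston 2006, Thm. 5.1.3 with source `f₀ = g` and target `f = f_E` (Thm. 4.4.5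
for `μ^an`), bounded (print-faithful) interpolant — level-generic twin of
`thm513_transfer_from_weightK_member_of_bdd`: the source `g` a good-ordinary weight-`k` member of
`H(E[p])` of ANY tame level `M` prime to `p`.** Thm. 5.1.3 (arXiv:math/0404484 p. 30): "Suppose
that `μ^alg(f₀,ω^i) = μ^an(f₀,ω^i) = 0` and `λ^alg(f₀,ω^i) = λ^an(f₀,ω^i)` for some `f₀` in the
Hida family attached to `ρ̄` and some `i`. Then `μ^alg(f,ω^i) = μ^an(f,ω^i) = 0` and
`λ^alg(f,ω^i) = λ^an(f,ω^i)` for every `f` in the Hida family attached to `ρ̄`" — `f₀`, `f` range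
over the WHOLE family ("the set of all `p`-ordinary `p`-stabilized newforms `f` with mod `p` Galois
representation isomorphic to `ρ̄`", p. 2), the tame levels of `f₀` and `f` may differ (the theorem
compares `alg` with `an` at EACH member; the level-change terms `e_ℓ` of Thm. 2 are "identical both
algebraically and analytically", p. 2); Thm. 4.4.5 (p. 24): `μ^an` vanishes for one ordinary
newform of the family iff for every one. Instance, bridges, hypotheses (`μ^alg(g) = 0`,
`λ^alg(g) = λ^an(g)` for THE bounded cyclotomic `p`-adic `L`-function of `(g, ι, υ)`,
`μ^an(f_E) = 0` Néron-normalised) and CONCLUSION at `f = f_E` (unit contents and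
`normLam gK = normLam fE` at every Kato pair) VERBATIM as in
`thm513_transfer_from_weightK_member_of_bdd` and the module docstring; ONLY the member binder
block differs (`M`, `p ∤ M`, `IsOrdinaryMemberOfLevel`; that fact is this one at `M = N/p`:
`thm513_transfer_from_weightK_member_of_bdd.of_ofLevel`). Flag as there (`EPW-canonical-period`).
Named fact; nothing asserted; no `_holds`.
-- TODO(general form): Thm. 5.1.3 for arbitrary f₀, f ∈ H(ρ̄), twists ω^i; μ^an via canonical periods.
[cite: EmertonPollackWeston2006, Thm. 5.1.3 (arXiv:math/0404484 p. 30), Thm. 4.4.5 and Def. 4.4.6 (p. 24), Thm. 1, Thm. 2 and Intro p. 2 (H(ρ̄)), Ex. 5.3.1 (p. 32)]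
[cite: Skinner2016PacificMC, §3.2 (arXiv:1407.1093 p0014) and §3.3 (p0016)]
[cite: GreenbergVatsal2000, §3 Prop. (3.1), Prop. (3.3)]
[cite: MazurTateTeitelbaum1986Invent, §I.11 and §I.14 (14.3)] -/
def thm513_transfer_from_weightK_member_of_bdd_ofLevel : Prop :=
  ∀ (W : WeierstrassCurve ℚ) [W.IsElliptic] [W.IsGloballyMinimal] (p : ℕ) [Fact p.Prime],
    5 ≤ p → W.HasMultiplicativeReductionAtPrime p → W.HasIrreducibleModPGaloisRep p →
    ∀ {M : ℕ} [NeZero M], ¬ p ∣ M → ∀ {k : ℤ} (g : CuspForm (Gamma0 M) k)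
      (ι : coeffField g →+* PadicAlgCl p), IsOrdinaryMemberOfLevel W p g ι →
    ∀ (𝔇 : OrdinaryPadicData g p ι) (κ : ZpExtension ℚ p) (γ : Field.absoluteGaloisGroup ℚ),
      κ.IsCyclotomic → κ.IsTopGenerator γ → IsCyclotomicVariable p γ →
    ∀ (D : GreenbergSelmer.DualData (padicCoeffField (memberGenerators g ι 𝔇.υ)) κ γ 𝔇.ρ 𝔇.plus),
      Module.IsTorsion (PowerSeries (padicCoeffIntegers (memberGenerators g ι 𝔇.υ))) D.X →
    ∀ G : PowerSeries (padicCoeffIntegers (memberGenerators g ι 𝔇.υ)),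
      D.charIdeal = Ideal.span {G} →
    ∀ (Dsym : PeriodSymbolDatum g) (L : PowerSeries (PadicAlgCl p)),
      IsCycPAdicLFunctionWeightK g Dsym p ι 𝔇.υ L →
      (∃ C : ℝ, ∀ i, ‖PowerSeries.coeff i L‖ ≤ C) →
    -- hypotheses of Thm. 5.1.3 at `f₀ = g`: `μ^alg(g) = 0`, `λ^alg(g) = λ^an(g)` …
    (∃ n : ℕ, ‖((PowerSeries.coeff n G : padicCoeffIntegers (memberGenerators g ι 𝔇.υ)) :
        PadicAlgCl p)‖ = 1) →
    normLam (PowerSeries.map (padicCoeffIntegers (memberGenerators g ι 𝔇.υ)).subtype G) = normLam L →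
    -- … and `μ^an(g) = 0` in the form `μ^an(f_E) = 0` (Thm. 4.4.5), Néron-normalised
    (∀ {N : ℕ} [NeZero N] (f : CuspForm (Gamma0 N) 2), IsNewformOf W f →
        ∀ (ϖ : ℚ), (ϖ : ℝ) * W.realPeriodRat = plusPeriod f →
          (¬ W.HasSplitMultiplicativeReductionAtPrime p →
            ∀ Lp : PowerSeries ℚ_[p], IsMultPAdicLFunctionOf f p (-1) Lp →
              ∃ n : ℕ, ‖PowerSeries.coeff n (PowerSeries.C ((ϖ : ℚ) : ℚ_[p]) * Lp)‖ = 1) ∧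
          (W.HasSplitMultiplicativeReductionAtPrime p →
            ∀ Lp : PowerSeries ℚ_[p], IsSplitMultPAdicLFunctionOf f p Lp →
              ∃ n : ℕ, ‖PowerSeries.coeff n (PowerSeries.C ((ϖ : ℚ) : ℚ_[p]) * Lp)‖ = 1)) →
    -- conclusion at `f = f_E`: `μ = 0` and `λ^alg(f_E) = λ^an(f_E)`, at every Kato pair
    ∀ (κ' : ZpExtension ℚ p) (γ' : Field.absoluteGaloisGroup ℚ),
        κ'.IsCyclotomic → κ'.IsTopGenerator γ' → IsCyclotomicVariable p γ' →
      ∀ {N : ℕ} [NeZero N] (f : CuspForm (Gamma0 N) 2), IsNewformOf W f →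
      ∀ (D' : W.SelmerDualData κ' γ') (ϖ : ℚ), (ϖ : ℝ) * W.realPeriodRat = plusPeriod f →
      ∀ (fE gK : IwasawaAlgebra p), D'.charIdeal = Ideal.span {fE} →
        (¬ W.HasSplitMultiplicativeReductionAtPrime p →
          ∀ Lp : PowerSeries ℚ_[p], IsMultPAdicLFunctionOf f p (-1) Lp →
            iwasawaToPowerSeries p gK = PowerSeries.C ((ϖ : ℚ) : ℚ_[p]) * Lp →
              HasUnitContent gK ∧ HasUnitContent fE ∧ normLam gK = normLam fE) ∧
        (W.HasSplitMultiplicativeReductionAtPrime p →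
          ∀ Lp : PowerSeries ℚ_[p], IsSplitMultPAdicLFunctionOf f p Lp →
            iwasawaToPowerSeries p (PowerSeries.X * gK) = PowerSeries.C ((ϖ : ℚ) : ℚ_[p]) * Lp →
              HasUnitContent gK ∧ HasUnitContent fE ∧ normLam gK = normLam fE)

/-- The level-`N/p` instance `thm513_transfer_from_weightK_member_of_bdd` IS the level-generic twin
at `M := N/p`. Deprecate-and-add bookkeeping: the old fact is implied by (weaker than) the new one.
[cite: EmertonPollackWeston2006, Thm. 5.1.3 (arXiv:math/0404484 p. 30)] -/
theorem thm513_transfer_from_weightK_member_of_bdd.of_ofLevel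
    (h : thm513_transfer_from_weightK_member_of_bdd_ofLevel) :
    thm513_transfer_from_weightK_member_of_bdd := by
  intro W _ _ p _ hp hmult hirr _ k g ι hmem 𝔇 κ γ hκ hγ hγ' D htors G hG Dsym L hL hbdd hμg hlam hμan
  exact h W p hp hmult hirr (not_dvd_conductorNorm_div_of_hasMultiplicativeReductionAtPrime W p hmult)
    g ι (IsOrdinaryMemberOf.ofLevel hmem) 𝔇 κ γ hκ hγ hγ' D htors G hG Dsym L hL hbdd hμg hlam hμan

end Literature.NumberTheory.EllipticCurves.EmertonPollackWeston2006

end
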